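import Mathlib.Algebra.Module.LinearMap.End
import Mathlib.Tactic.NoncommRing
import Mathlib.Tactic.Abel
import HarnessLib

/-!
# The homological perturbation lemma (algebraic identities)

[topic Algebra/Homology]

Crainic's form of the classical (Brown–Gugenheim) homological perturbation lemma
[M. Crainic, *On the perturbation lemma, and deformations*, arXiv:math/0403266 (2004), §2].
A **homotopy equivalence (HE) data** consists of two complexes `(L, b_L)`, `(M, b)`, chain maps
`i : L → M`, `p : M → L` and a homotopy `h` on `M` with `i p = 1 + b h + h b` (2.1). A
**perturbation** is a map `δ` on `M` with `(b + δ)² = 0`; it is **small** if `1 - δ h` is invertible,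
and then `A := (1 - δ h)⁻¹ δ` and the **perturbed data** are (2.2)
`i₁ = i + h A i`, `p₁ = p + p A h`, `h₁ = h + h A h`, `b₁ = b_L + p A i`.
The Main Perturbation Lemma (2.4) says the perturbed data are again HE data for the perturbed
differential `b + δ`; Remark 2.3 (i)/(iii) adds that the side conditions of a *special deformation
retract* (`h i = 0`, `p h = 0`, `h² = 0`, together with `p i = 1`) survive the perturbation
(all three side conditions are used for each of them).

Everything below is the ALGEBRA of that statement, for modules over a ring `R` and `R`-linear
maps, UNGRADED (a complex is a module with a square-zero endomorphism; the grading of the source is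
bookkeeping that every identity below respects degree by degree) and with smallness replaced by
exactly what the proof uses, the two relations of Crainic's Lemma (i): `δ h A = A - δ` and
`A h δ = A - δ` (`small_of_inverse` derives them from a two-sided inverse of `1 - δ h`, i.e. from
smallness as printed). The quasi-isomorphism clause of (2.4) (its step 6)) is about homology and is
NOT formalised here; for a special deformation retract it is immediate from `p₁ i₁ = 1` and 4).

* `inv_one_sub_δh`, `inv_one_sub_δh'`, `inv_one_sub_hδ`, `inv_one_sub_hδ'` — Lemma (ii):
  `1 + A h` is a two-sided inverse of `1 - δ h` and `1 + h A` one of `1 - h δ`;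
* `AipA` — Lemma (iii): `A (i p) A + A b + b A = 0`;
* `perturbed_sq_zero` — 1) `b₁² = 0`;
* `perturbed_i_chain` — 2) `i₁ b₁ = (b + δ) i₁`;
* `perturbed_p_chain` — 3) `b₁ p₁ = p₁ (b + δ)`;
* `perturbed_homotopy` — 4) `i₁ p₁ = 1 + (b + δ) h₁ + h₁ (b + δ)`;
* `perturbed_hi`, `perturbed_ph`, `perturbed_hh`, `perturbed_pi` — the special
  deformation retract conditions are preserved (Remark 2.3 (i), (iii));
* `small_of_inverse` — smallness ⇒ the two relations (Lemma (i)).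

All declarations live in the namespace `Literature.Algebra.Homology.HomologicalPerturbation`.
Maps on `M` are elements of the ring `Module.End R M` (`*` is composition); `i`, `p` are linear maps
composed with `∘ₗ`. No grading, filtration, topology or category appears.
-/

namespace Literature.Algebra.Homology

namespace HomologicalPerturbation

variable {R : Type*} [Ring R]
variable {L M : Type*} [AddCommGroup L] [Module R L] [AddCommGroup M] [Module R M]
variable {bL : Module.End R L} {b δ h A : Module.End R M} {i : L →ₗ[R] M} {p : M →ₗ[R] L}

/-! ### Crainic's Lemma: the relations satisfied by `A` -/

/-- From `δ h A = A - δ`: `(1 - δ h) A = δ`. [cite: Crainic2004, §2.4 Lemma (i)] -/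
theorem one_sub_δh_mul_A (hA1 : δ * h * A = A - δ) : (1 - δ * h) * A = δ := by
  rw [sub_mul, one_mul, hA1]; abel

/-- From `A h δ = A - δ`: `A (1 - h δ) = δ`. [cite: Crainic2004, §2.4 Lemma (i)] -/
theorem A_mul_one_sub_hδ (hA2 : A * h * δ = A - δ) : A * (1 - h * δ) = δ := by
  rw [mul_sub, mul_one, ← mul_assoc, hA2]; abel

/-- Lemma (ii), right inverse: `(1 - δ h)(1 + A h) = 1`. [cite: Crainic2004, §2.4 Lemma (ii)] -/
theorem inv_one_sub_δh (hA1 : δ * h * A = A - δ) : (1 - δ * h) * (1 + A * h) = 1 := by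
  have e : (1 - δ * h) * (1 + A * h) = 1 + ((1 - δ * h) * A - δ) * h := by noncomm_ring
  rw [e, one_sub_δh_mul_A hA1, sub_self, zero_mul, add_zero]

/-- Lemma (ii), left inverse: `(1 + A h)(1 - δ h) = 1`. [cite: Crainic2004, §2.4 Lemma (ii)] -/
theorem inv_one_sub_δh' (hA2 : A * h * δ = A - δ) : (1 + A * h) * (1 - δ * h) = 1 := by
  have e : (1 + A * h) * (1 - δ * h) = 1 + (A * (1 - h * δ) - δ) * h := by noncomm_ring
  rw [e, A_mul_one_sub_hδ hA2, sub_self, zero_mul, add_zero]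

/-- Lemma (ii), right inverse: `(1 - h δ)(1 + h A) = 1`. [cite: Crainic2004, §2.4 Lemma (ii)] -/
theorem inv_one_sub_hδ (hA1 : δ * h * A = A - δ) : (1 - h * δ) * (1 + h * A) = 1 := by
  have e : (1 - h * δ) * (1 + h * A) = 1 + h * ((1 - δ * h) * A - δ) := by noncomm_ring
  rw [e, one_sub_δh_mul_A hA1, sub_self, mul_zero, add_zero]

/-- Lemma (ii), left inverse: `(1 + h A)(1 - h δ) = 1`. [cite: Crainic2004, §2.4 Lemma (ii)] -/
theorem inv_one_sub_hδ' (hA2 : A * h * δ = A - δ) : (1 + h * A) * (1 - h * δ) = 1 := by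
  have e : (1 + h * A) * (1 - h * δ) = 1 + h * (A * (1 - h * δ) - δ) := by noncomm_ring
  rw [e, A_mul_one_sub_hδ hA2, sub_self, mul_zero, add_zero]

/-- **Crainic's Lemma (iii).** If an endomorphism `P` of `M` (in the lemma: `P = i p`) satisfies
`P = 1 + b h + h b`, and `b² = 0`, `(b + δ)² = 0`, `δ h A = A - δ`, `A h δ = A - δ`, then
`A P A + A b + b A = 0`. [cite: Crainic2004, §2.4 Lemma (iii)] -/
theorem AipA {P : Module.End R M} (hP : P = 1 + b * h + h * b) (hb : b * b = 0)
    (hD : (b + δ) * (b + δ) = 0) (hA1 : δ * h * A = A - δ) (hA2 : A * h * δ = A - δ) :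
    A * P * A + A * b + b * A = 0 := by
  have e1 := one_sub_δh_mul_A hA1
  have e2 := A_mul_one_sub_hδ hA2
  have k1 := inv_one_sub_δh hA1
  have k2 := inv_one_sub_δh' hA2
  have k3 := inv_one_sub_hδ hA1
  have k4 := inv_one_sub_hδ' hA2
  -- `A P A + A b + b A = A² + A b (1 + hA) + (1 + Ah) b A`
  have step1 : A * P * A + A * b + b * A
      = A * A + A * b * (1 + h * A) + (1 + A * h) * b * A := by rw [hP]; noncomm_ring
  -- sandwich with `(1 + Ah)(1 - δh) = 1` on the left and `(1 - hδ)(1 + hA) = 1` on the right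
  have step2 : ∀ X : Module.End R M,
      X = (1 + A * h) * ((1 - δ * h) * X * (1 - h * δ)) * (1 + h * A) := by
    intro X
    have : (1 + A * h) * ((1 - δ * h) * X * (1 - h * δ)) * (1 + h * A)
        = ((1 + A * h) * (1 - δ * h)) * X * ((1 - h * δ) * (1 + h * A)) := by noncomm_ring
    rw [this, k2, k3, one_mul, mul_one]
  have step3 : (1 - δ * h) * (A * A + A * b * (1 + h * A) + (1 + A * h) * b * A) * (1 - h * δ)
      = ((1 - δ * h) * A) * (A * (1 - h * δ)) + ((1 - δ * h) * A) * b * ((1 + h * A) * (1 - h * δ))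
        + ((1 - δ * h) * (1 + A * h)) * b * (A * (1 - h * δ)) := by noncomm_ring
  rw [step1, step2 (A * A + A * b * (1 + h * A) + (1 + A * h) * b * A), step3, e1, e2, k4, k1,
    mul_one, one_mul]
  have hδ : δ * δ + δ * b + b * δ = 0 := by
    have : (b + δ) * (b + δ) = b * b + (δ * δ + δ * b + b * δ) := by noncomm_ring
    rw [this, hb, zero_add] at hD; exact hD
  rw [hδ, mul_zero, zero_mul]

/-! ### The perturbed data -/

/-- The perturbed inclusion `i₁ = i + h A i`, pointwise. [cite: Crainic2004, §2.2] -/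
theorem i1_apply (x : L) : (i + (h * A) ∘ₗ i) x = i x + h (A (i x)) := rfl

/-- The perturbed projection `p₁ = p + p A h`, pointwise. [cite: Crainic2004, §2.2] -/
theorem p1_apply (y : M) : (p + p ∘ₗ (A * h)) y = p y + p (A (h y)) := rfl

/-- The perturbed homotopy `h₁ = h + h A h`, pointwise. [cite: Crainic2004, §2.2] -/
theorem h1_apply (y : M) : (h + h * A * h) y = h y + h (A (h y)) := rfl

/-- The perturbed differential of `L`, `b₁ = b_L + p A i`, pointwise. [cite: Crainic2004, §2.2] -/
theorem b1_apply (x : L) : (bL + p ∘ₗ A ∘ₗ i) x = bL x + p (A (i x)) := rfl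

/-! ### Pointwise forms of the hypotheses -/

/-- Pointwise form of Lemma (iii): `A (i (p (A y))) = -(A (b y)) - b (A y)`.
[cite: Crainic2004, §2.4 Lemma (iii)] -/
theorem AipA_apply (hip : i ∘ₗ p = 1 + b * h + h * b) (hb : b * b = 0)
    (hD : (b + δ) * (b + δ) = 0) (hA1 : δ * h * A = A - δ) (hA2 : A * h * δ = A - δ) (y : M) :
    A (i (p (A y))) = -(A (b y)) - b (A y) := by
  have e := LinearMap.congr_fun (AipA (A := A) hip hb hD hA1 hA2) y
  simp only [LinearMap.add_apply, Module.End.mul_apply, LinearMap.zero_apply,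
    LinearMap.comp_apply] at e
  rw [← sub_eq_zero, ← e]; abel

/-- `i (p y) = y + b (h y) + h (b y)`. [cite: Crainic2004, §2.1 (ii)] -/
theorem ip_apply (hip : i ∘ₗ p = 1 + b * h + h * b) (y : M) :
    i (p y) = y + b (h y) + h (b y) := by
  simpa only [LinearMap.comp_apply, LinearMap.add_apply, Module.End.mul_apply,
    Module.End.one_apply] using LinearMap.congr_fun hip y

/-- Pointwise expanded form of Lemma (iii) (with `i p = 1 + bh + hb` substituted), solved for
the term `A h b A`: `A (h (b (A z))) = -(b (A z)) - A (b z) - A (A z) - A (b (h (A z)))`.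
[cite: Crainic2004, §2.4 Lemma (iii)] -/
theorem AhbA_apply (hip : i ∘ₗ p = 1 + b * h + h * b) (hb : b * b = 0)
    (hD : (b + δ) * (b + δ) = 0) (hA1 : δ * h * A = A - δ) (hA2 : A * h * δ = A - δ) (z : M) :
    A (h (b (A z))) = -(b (A z)) - A (b z) - A (A z) - A (b (h (A z))) := by
  have e := LinearMap.congr_fun (AipA (A := A) hip hb hD hA1 hA2) z
  simp only [LinearMap.add_apply, Module.End.mul_apply, LinearMap.zero_apply,
    LinearMap.comp_apply, ip_apply hip, map_add] at e
  rw [← sub_eq_zero, ← e]; abel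

/-- `δ (h (A y)) = A y - δ y`. [cite: Crainic2004, §2.4 Lemma (i)] -/
theorem δhA_apply (hA1 : δ * h * A = A - δ) (y : M) : δ (h (A y)) = A y - δ y := by
  simpa only [Module.End.mul_apply, LinearMap.sub_apply] using LinearMap.congr_fun hA1 y

/-- `A (h (δ y)) = A y - δ y`. [cite: Crainic2004, §2.4 Lemma (i)] -/
theorem Ahδ_apply (hA2 : A * h * δ = A - δ) (y : M) : A (h (δ y)) = A y - δ y := by
  simpa only [Module.End.mul_apply, LinearMap.sub_apply] using LinearMap.congr_fun hA2 y

/-! ### The Main Perturbation Lemma -/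

/-- **Main Perturbation Lemma, 1)**: the perturbed differential of `L` squares to zero,
`b₁² = 0`. Hypotheses: `b_L² = 0`, `b² = 0`, `(b + δ)² = 0`, `i`, `p` chain maps, `i p = 1 + bh + hb`,
and the two relations of `A`. [cite: Crainic2004, §2.4 Main Perturbation Lemma, step 1)] -/
theorem perturbed_sq_zero (hbL : bL * bL = 0) (hb : b * b = 0) (hD : (b + δ) * (b + δ) = 0)
    (hi : i ∘ₗ bL = b ∘ₗ i) (hp : p ∘ₗ b = bL ∘ₗ p) (hip : i ∘ₗ p = 1 + b * h + h * b)
    (hA1 : δ * h * A = A - δ) (hA2 : A * h * δ = A - δ) :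
    (bL + p ∘ₗ A ∘ₗ i) * (bL + p ∘ₗ A ∘ₗ i) = 0 := by
  have hi' : ∀ x, i (bL x) = b (i x) := fun x => by
    simpa only [LinearMap.comp_apply] using LinearMap.congr_fun hi x
  have hp' : ∀ y, p (b y) = bL (p y) := fun y => by
    simpa only [LinearMap.comp_apply] using LinearMap.congr_fun hp y
  have hbL' : ∀ x, bL (bL x) = 0 := fun x => by
    simpa only [Module.End.mul_apply, LinearMap.zero_apply] using LinearMap.congr_fun hbL x
  ext x
  simp only [Module.End.mul_apply, LinearMap.add_apply, LinearMap.comp_apply,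
    LinearMap.zero_apply, map_add, hbL', hi', AipA_apply hip hb hD hA1 hA2, map_neg, map_sub, hp']
  abel

/-- **Main Perturbation Lemma, 2)**: `i₁` is a chain map from `(L, b₁)` to `(M, b + δ)`:
`i₁ b₁ = (b + δ) i₁`. [cite: Crainic2004, §2.4 Main Perturbation Lemma, step 2)] -/
theorem perturbed_i_chain (hb : b * b = 0) (hD : (b + δ) * (b + δ) = 0)
    (hi : i ∘ₗ bL = b ∘ₗ i) (hip : i ∘ₗ p = 1 + b * h + h * b)
    (hA1 : δ * h * A = A - δ) (hA2 : A * h * δ = A - δ) :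
    (i + (h * A) ∘ₗ i) ∘ₗ (bL + p ∘ₗ A ∘ₗ i) = (b + δ) ∘ₗ (i + (h * A) ∘ₗ i) := by
  have hi' : ∀ x, i (bL x) = b (i x) := fun x => by
    simpa only [LinearMap.comp_apply] using LinearMap.congr_fun hi x
  ext x
  simp only [LinearMap.comp_apply, LinearMap.add_apply, Module.End.mul_apply, map_add, hi',
    ip_apply hip, AhbA_apply hip hb hD hA1 hA2, δhA_apply hA1, map_neg, map_sub]
  abel

/-- **Main Perturbation Lemma, 3)**: `p₁` is a chain map from `(M, b + δ)` to `(L, b₁)`: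
`b₁ p₁ = p₁ (b + δ)`. [cite: Crainic2004, §2.4 Main Perturbation Lemma, step 3)] -/
theorem perturbed_p_chain (hb : b * b = 0) (hD : (b + δ) * (b + δ) = 0)
    (hp : p ∘ₗ b = bL ∘ₗ p) (hip : i ∘ₗ p = 1 + b * h + h * b)
    (hA1 : δ * h * A = A - δ) (hA2 : A * h * δ = A - δ) :
    (bL + p ∘ₗ A ∘ₗ i) ∘ₗ (p + p ∘ₗ (A * h)) = (p + p ∘ₗ (A * h)) ∘ₗ (b + δ) := by
  have hp' : ∀ y, p (b y) = bL (p y) := fun y => by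
    simpa only [LinearMap.comp_apply] using LinearMap.congr_fun hp y
  ext y
  simp only [LinearMap.comp_apply, LinearMap.add_apply, Module.End.mul_apply, map_add,
    ip_apply hip, AhbA_apply hip hb hD hA1 hA2, Ahδ_apply hA2, map_neg, map_sub, hp']
  abel

/-- **Main Perturbation Lemma, 4)**: `h₁` is a homotopy between `i₁ p₁` and `1` for the perturbed
differential: `i₁ p₁ = 1 + (b + δ) h₁ + h₁ (b + δ)`.
[cite: Crainic2004, §2.4 Main Perturbation Lemma, step 4)] -/
theorem perturbed_homotopy (hb : b * b = 0) (hD : (b + δ) * (b + δ) = 0)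
    (hip : i ∘ₗ p = 1 + b * h + h * b) (hA1 : δ * h * A = A - δ) (hA2 : A * h * δ = A - δ) :
    (i + (h * A) ∘ₗ i) ∘ₗ (p + p ∘ₗ (A * h))
      = 1 + (b + δ) * (h + h * A * h) + (h + h * A * h) * (b + δ) := by
  ext y
  simp only [LinearMap.comp_apply, LinearMap.add_apply, Module.End.mul_apply,
    Module.End.one_apply, map_add, ip_apply hip, AhbA_apply hip hb hD hA1 hA2, δhA_apply hA1,
    Ahδ_apply hA2, map_neg, map_sub]
  abel

/-! ### Special deformation retracts stay special (Remark 2.3 (i), (iii)) -/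

/-- If `h i = 0` and `h² = 0` then `h₁ i₁ = 0`. [cite: Crainic2004, §2.3 Remark (i), (iii)] -/
theorem perturbed_hi (hhi : h ∘ₗ i = 0) (hhh : h * h = 0) :
    (h + h * A * h) ∘ₗ (i + (h * A) ∘ₗ i) = 0 := by
  have e : ∀ x, h (i x) = 0 := fun x => by
    simpa only [LinearMap.comp_apply, LinearMap.zero_apply] using LinearMap.congr_fun hhi x
  have e' : ∀ y, h (h y) = 0 := fun y => by
    simpa only [Module.End.mul_apply, LinearMap.zero_apply] using LinearMap.congr_fun hhh y
  ext x
  simp only [LinearMap.comp_apply, LinearMap.add_apply, Module.End.mul_apply,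
    LinearMap.zero_apply, map_add, e, e', map_zero, add_zero]

/-- If `p h = 0` and `h² = 0` then `p₁ h₁ = 0`. [cite: Crainic2004, §2.3 Remark (i), (iii)] -/
theorem perturbed_ph (hph : p ∘ₗ h = 0) (hhh : h * h = 0) :
    (p + p ∘ₗ (A * h)) ∘ₗ (h + h * A * h) = 0 := by
  have e : ∀ y, p (h y) = 0 := fun y => by
    simpa only [LinearMap.comp_apply, LinearMap.zero_apply] using LinearMap.congr_fun hph y
  have e' : ∀ y, h (h y) = 0 := fun y => by
    simpa only [Module.End.mul_apply, LinearMap.zero_apply] using LinearMap.congr_fun hhh y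
  ext y
  simp only [LinearMap.comp_apply, LinearMap.add_apply, Module.End.mul_apply,
    LinearMap.zero_apply, map_add, e, e', map_zero, add_zero]

/-- If `h² = 0` then `h₁² = 0`. [cite: Crainic2004, §2.3 Remark (i), (iii)] -/
theorem perturbed_hh (hhh : h * h = 0) : (h + h * A * h) * (h + h * A * h) = 0 := by
  have e : ∀ y, h (h y) = 0 := fun y => by
    simpa only [Module.End.mul_apply, LinearMap.zero_apply] using LinearMap.congr_fun hhh y
  ext y
  simp only [Module.End.mul_apply, LinearMap.add_apply, LinearMap.zero_apply, map_add, e,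
    map_zero, add_zero]

/-- If `p i = 1`, `h i = 0`, `p h = 0` and `h² = 0` (a special deformation retract) then
`p₁ i₁ = 1`. [cite: Crainic2004, §2.3 Remark (i), (iii)] -/
theorem perturbed_pi (hpi : p ∘ₗ i = 1) (hhi : h ∘ₗ i = 0) (hph : p ∘ₗ h = 0) (hhh : h * h = 0) :
    (p + p ∘ₗ (A * h)) ∘ₗ (i + (h * A) ∘ₗ i) = 1 := by
  have e1 : ∀ x, h (i x) = 0 := fun x => by
    simpa only [LinearMap.comp_apply, LinearMap.zero_apply] using LinearMap.congr_fun hhi x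
  have e2 : ∀ y, p (h y) = 0 := fun y => by
    simpa only [LinearMap.comp_apply, LinearMap.zero_apply] using LinearMap.congr_fun hph y
  have e3 : ∀ x, p (i x) = x := fun x => by
    simpa only [LinearMap.comp_apply, Module.End.one_apply] using LinearMap.congr_fun hpi x
  have e4 : ∀ y, h (h y) = 0 := fun y => by
    simpa only [Module.End.mul_apply, LinearMap.zero_apply] using LinearMap.congr_fun hhh y
  ext x
  simp only [LinearMap.comp_apply, LinearMap.add_apply, Module.End.mul_apply,
    Module.End.one_apply, map_add, e1, e2, e3, e4, map_zero, add_zero]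

/-! ### Smallness gives the two relations (Lemma (i)) -/

/-- If `u` is a two-sided inverse of `1 - δ h` and `A = u δ` (that is `A = (1 - δ h)⁻¹ δ`, the
definition of `A` for a SMALL perturbation), then `δ h A = A - δ` and `A h δ = A - δ`.
[cite: Crainic2004, §2.4 Lemma (i)] -/
theorem small_of_inverse {u : Module.End R M} (hu1 : (1 - δ * h) * u = 1)
    (hu2 : u * (1 - δ * h) = 1) (hA : A = u * δ) :
    δ * h * A = A - δ ∧ A * h * δ = A - δ := by
  constructor
  · have e : (1 - δ * h) * A = δ := by rw [hA, ← mul_assoc, hu1, one_mul]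
    have : δ * h * A = A - (1 - δ * h) * A := by noncomm_ring
    rw [this, e]
  · have e : A * h * δ = u * (δ - (1 - δ * h) * δ) := by rw [hA]; noncomm_ring
    rw [e, mul_sub, ← mul_assoc, hu2, one_mul, hA]

end HomologicalPerturbation

end Literature.Algebra.Homology
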